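import Mathlib
import HarnessLib

/-!
# Kunisky–Yu `T^{4,4,1}`, step 1: translation Fourier reduction of a pair-kernel form — PROVED

Topic `Literature/Combinatorics/SimpleGraph`; support file for the Kunisky–Yu degree-4 SOS lower
bound for the Paley clique number (`PaleySos.lean`, fact `kuniskyYu2022_theorem_1_2`), more
precisely for the norm bound on the graph matrix `T^{4,4,1}` [cite: KuniskyYu2022, Theorem 3.35].

Kunisky–Yu (§4.7.1, Propositions 4.18–4.19) block-diagonalise the matrix
`T̃_{(a,b),(c,d)} = χ((a−c)(a−d)(b−c)(b−d))` on ORDERED pairs using its invariance under the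
affine group of `𝔽_p`.  We use the translations only, and phrase everything as finite sums
(no operator norms): writing `b = a + s`, `d = c + t`, the entry is `g_{s,t}(a − c)` for a kernel
`g : 𝔽_p → 𝔽_p → 𝔽_p → ℂ`, and for ANY such kernel and any family `x_s : 𝔽_p → ℂ`
(think `x_s(a) = V_{a,a+s}`),

  `∑_{s,t} ∑_{a,c} x_s(a) conj(x_t(c)) g_{s,t}(a − c)
      = p⁻¹ ∑_r ∑_{s,t} A_s(r) conj(A_t(r)) Ĝ_{s,t}(r)`,

`A_s(r) = ∑_a x_s(a) e(−ra/p)`, `Ĝ_{s,t}(r) = ∑_u g_{s,t}(u) e(ru/p)` (`sum_sum_kernel_sub_eq`,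
orthogonality of additive characters).  Hence (`norm_translationKernel_form_le`) a uniform bound
`|∑_{s,t} y_s conj(y_t) Ĝ_{s,t}(r)| ≤ B ∑_s |y_s|²` for every frequency `r` (and every `y` with
`y_0 = 0`) gives `|form| ≤ B ∑_{s,a} |x_s(a)|²` (Parseval, `sum_norm_sq_fourier_eq`).  If moreover
the kernel is dilation invariant, `g_{rs,rt}(ru) = g_{s,t}(u)` for `r ≠ 0` (true for the Paley
kernel since `χ(r)⁴ = 1`), all non-zero frequencies are equivalent to `r = 1`
(`translationKernel_bound_of_one`; this is Kunisky–Yu's Proposition 4.19(2), "the `S(ψ)` have a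
common set of eigenvalues").  The two remaining frequency classes `r = 0` and `r = 1` are bounded
in `PaleyT441M0.lean` and `PaleyT441M1.lean`.

## References

* D. Kunisky, X. Yu, arXiv:2211.02713 (2022), §4.7.1, Propositions 4.18, 4.19.  [KuniskyYu2022]
-/

noncomputable section

open Finset

namespace Literature.Combinatorics.SimpleGraph

section Fourier

variable {p : ℕ} [hp : Fact p.Prime]

/-- Complex conjugation of the standard additive character: `conj e(x/p) = e(−x/p)`. [folklore] -/
theorem conj_stdAddChar (x : ZMod p) :
    (starRingEnd ℂ) (ZMod.stdAddChar x : ℂ) = ZMod.stdAddChar (-x) :=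
  (AddChar.map_neg_eq_conj _ x).symm

/-- **Fourier expansion of a difference kernel** on `ℤ/pℤ`:
`∑_{a,c} f(a) h(c) g(a − c) = p⁻¹ ∑_r (∑_a f(a) e(−ra)) (∑_c h(c) e(rc)) (∑_u g(u) e(ru))`.
[folklore] -/
theorem sum_sum_kernel_sub_eq (f h g : ZMod p → ℂ) :
    ∑ a : ZMod p, ∑ c : ZMod p, f a * h c * g (a - c) =
      (p : ℂ)⁻¹ * ∑ r : ZMod p, ((∑ a : ZMod p, f a * ZMod.stdAddChar (-(r * a))) *
        (∑ c : ZMod p, h c * ZMod.stdAddChar (r * c)) *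
        (∑ u : ZMod p, g u * ZMod.stdAddChar (r * u))) := by
  have hp0 : (p : ℂ) ≠ 0 := by exact_mod_cast hp.out.ne_zero
  have horth : ∀ b : ZMod p, ∑ r : ZMod p, (ZMod.stdAddChar (r * b) : ℂ) =
      if b = 0 then (p : ℂ) else 0 := by
    intro b
    classical
    rw [AddChar.sum_mulShift b (ZMod.isPrimitive_stdAddChar p), ZMod.card]
    split_ifs <;> simp
  -- `∑_u g(u) ∑_r e(r(u + c - a)) = p g(a - c)`
  have key : ∀ a c : ZMod p,
      ∑ u : ZMod p, g u * ∑ r : ZMod p, (ZMod.stdAddChar (r * (u + c - a)) : ℂ) =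
        (p : ℂ) * g (a - c) := by
    intro a c
    have h1 : ∀ u : ZMod p, g u * ∑ r : ZMod p, (ZMod.stdAddChar (r * (u + c - a)) : ℂ) =
        if u = a - c then (p : ℂ) * g u else 0 := by
      intro u
      rw [horth]
      by_cases hu : u = a - c
      · rw [if_pos hu, if_pos (by rw [hu]; ring)]
        ring
      · rw [if_neg hu, if_neg (by
          intro h0
          exact hu (by linear_combination h0))]
        ring
    simp_rw [h1]
    rw [Finset.sum_ite_eq' Finset.univ (a - c)]
    simp
  -- expand the right-hand side into a fourfold sum and resum over `r` last
  have hR : ∑ r : ZMod p, ((∑ a : ZMod p, f a * ZMod.stdAddChar (-(r * a))) *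
        (∑ c : ZMod p, h c * ZMod.stdAddChar (r * c)) *
        (∑ u : ZMod p, g u * ZMod.stdAddChar (r * u))) =
      ∑ a : ZMod p, ∑ c : ZMod p, f a * h c *
        ∑ u : ZMod p, g u * ∑ r : ZMod p, (ZMod.stdAddChar (r * (u + c - a)) : ℂ) := by
    have h2 : ∀ r : ZMod p, ((∑ a : ZMod p, f a * ZMod.stdAddChar (-(r * a))) *
        (∑ c : ZMod p, h c * ZMod.stdAddChar (r * c)) *
        (∑ u : ZMod p, g u * ZMod.stdAddChar (r * u))) =
        ∑ a : ZMod p, ∑ c : ZMod p, f a * h c *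
          ∑ u : ZMod p, g u * (ZMod.stdAddChar (r * (u + c - a)) : ℂ) := by
      intro r
      rw [Finset.sum_mul_sum, Finset.sum_mul]
      refine Finset.sum_congr rfl fun a _ => ?_
      rw [Finset.sum_mul]
      refine Finset.sum_congr rfl fun c _ => ?_
      rw [Finset.mul_sum, Finset.mul_sum]
      refine Finset.sum_congr rfl fun u _ => ?_
      have he : (ZMod.stdAddChar (r * (u + c - a)) : ℂ) =
          ZMod.stdAddChar (-(r * a)) * ZMod.stdAddChar (r * c) * ZMod.stdAddChar (r * u) := by
        rw [← AddChar.map_add_eq_mul, ← AddChar.map_add_eq_mul]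
        congr 1
        ring
      rw [he]
      ring
    simp_rw [h2]
    rw [Finset.sum_comm]
    refine Finset.sum_congr rfl fun a _ => ?_
    rw [Finset.sum_comm]
    refine Finset.sum_congr rfl fun c _ => ?_
    rw [← Finset.mul_sum]
    congr 1
    rw [Finset.sum_comm]
    refine Finset.sum_congr rfl fun u _ => ?_
    rw [Finset.mul_sum]
  rw [hR]
  simp_rw [key]
  rw [Finset.mul_sum]
  refine Finset.sum_congr rfl fun a _ => ?_
  rw [Finset.mul_sum]
  refine Finset.sum_congr rfl fun c _ => ?_
  field_simp

/-- **Parseval** on `ℤ/pℤ`: `∑_r |∑_a f(a) e(−ra/p)|² = p ∑_a |f(a)|²`. [folklore] -/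
theorem sum_norm_sq_fourier_eq (f : ZMod p → ℂ) :
    ∑ r : ZMod p, ‖∑ a : ZMod p, f a * ZMod.stdAddChar (-(r * a))‖ ^ 2 =
      (p : ℝ) * ∑ a : ZMod p, ‖f a‖ ^ 2 := by
  have horth : ∀ b : ZMod p, ∑ r : ZMod p, (ZMod.stdAddChar (r * b) : ℂ) =
      if b = 0 then (p : ℂ) else 0 := by
    intro b
    classical
    rw [AddChar.sum_mulShift b (ZMod.isPrimitive_stdAddChar p), ZMod.card]
    split_ifs <;> simp
  -- complex form: `∑_r F(r) conj F(r) = p ∑_a f(a) conj f(a)`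
  have hC : ∑ r : ZMod p, (∑ a : ZMod p, f a * ZMod.stdAddChar (-(r * a))) *
      (starRingEnd ℂ) (∑ a : ZMod p, f a * ZMod.stdAddChar (-(r * a))) =
      (p : ℂ) * ∑ a : ZMod p, f a * (starRingEnd ℂ) (f a) := by
    have h1 : ∀ r : ZMod p, (starRingEnd ℂ) (∑ a : ZMod p, f a * ZMod.stdAddChar (-(r * a))) =
        ∑ a : ZMod p, (starRingEnd ℂ) (f a) * ZMod.stdAddChar (r * a) := by
      intro r
      rw [map_sum]
      refine Finset.sum_congr rfl fun a _ => ?_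
      rw [map_mul, conj_stdAddChar, neg_neg]
    simp_rw [h1]
    have h2 : ∀ r : ZMod p, (∑ a : ZMod p, f a * ZMod.stdAddChar (-(r * a))) *
        (∑ a : ZMod p, (starRingEnd ℂ) (f a) * ZMod.stdAddChar (r * a)) =
        ∑ a : ZMod p, ∑ a' : ZMod p, f a * (starRingEnd ℂ) (f a') *
          (ZMod.stdAddChar (r * (a' - a)) : ℂ) := by
      intro r
      rw [Finset.sum_mul_sum]
      refine Finset.sum_congr rfl fun a _ => Finset.sum_congr rfl fun a' _ => ?_
      have he : (ZMod.stdAddChar (r * (a' - a)) : ℂ) =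
          ZMod.stdAddChar (-(r * a)) * ZMod.stdAddChar (r * a') := by
        rw [← AddChar.map_add_eq_mul]
        congr 1
        ring
      rw [he]
      ring
    simp_rw [h2]
    rw [Finset.sum_comm]
    have h3 : ∀ a : ZMod p, ∑ r : ZMod p, ∑ a' : ZMod p, f a * (starRingEnd ℂ) (f a') *
        (ZMod.stdAddChar (r * (a' - a)) : ℂ) = (p : ℂ) * (f a * (starRingEnd ℂ) (f a)) := by
      intro a
      rw [Finset.sum_comm]
      have h4 : ∀ a' : ZMod p, ∑ r : ZMod p, f a * (starRingEnd ℂ) (f a') *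
          (ZMod.stdAddChar (r * (a' - a)) : ℂ) =
          if a' = a then (p : ℂ) * (f a * (starRingEnd ℂ) (f a')) else 0 := by
        intro a'
        rw [← Finset.mul_sum, horth]
        by_cases ha : a' = a
        · rw [if_pos ha, if_pos (by rw [ha]; ring)]
          ring
        · rw [if_neg ha, if_neg (by rwa [sub_eq_zero])]
          ring
      simp_rw [h4]
      rw [Finset.sum_ite_eq' Finset.univ a]
      simp
    simp_rw [h3]
    rw [Finset.mul_sum]
  simp_rw [Complex.mul_conj, Complex.normSq_eq_norm_sq] at hC
  exact_mod_cast hC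

/-- **Translation Fourier reduction** (the translation part of Kunisky–Yu's block-circulant
reduction, Propositions 4.18–4.19, as an inequality between finite sums): if for every frequency
`r` the `(s,t)`-form with kernel `Ĝ_{s,t}(r) = ∑_u g_{s,t}(u) e(ru/p)` is bounded by
`B ∑_s |y_s|²` on vectors with `y_0 = 0`, then the pair-kernel form
`∑_{s,t} ∑_{a,c} x_s(a) conj(x_t(c)) g_{s,t}(a − c)` is bounded by `B ∑_{s,a} |x_s(a)|²`
whenever `x_0 = 0`. [cite: KuniskyYu2022, Proposition 4.18] -/
theorem norm_translationKernel_form_le (g : ZMod p → ZMod p → ZMod p → ℂ) (B : ℝ)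
    (hB : ∀ r : ZMod p, ∀ y : ZMod p → ℂ, y 0 = 0 →
      ‖∑ s : ZMod p, ∑ t : ZMod p, y s * (starRingEnd ℂ) (y t) *
          ∑ u : ZMod p, g s t u * ZMod.stdAddChar (r * u)‖ ≤ B * ∑ s : ZMod p, ‖y s‖ ^ 2)
    (x : ZMod p → ZMod p → ℂ) (hx : ∀ a, x 0 a = 0) :
    ‖∑ s : ZMod p, ∑ t : ZMod p, ∑ a : ZMod p, ∑ c : ZMod p,
        x s a * (starRingEnd ℂ) (x t c) * g s t (a - c)‖ ≤
      B * ∑ s : ZMod p, ∑ a : ZMod p, ‖x s a‖ ^ 2 := by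
  have hp0 : (p : ℂ) ≠ 0 := by exact_mod_cast hp.out.ne_zero
  have hpR : (0 : ℝ) < p := by exact_mod_cast hp.out.pos
  -- the Fourier coefficients `A_s(r)`
  set A : ZMod p → ZMod p → ℂ := fun s r => ∑ a : ZMod p, x s a * ZMod.stdAddChar (-(r * a))
    with hA
  have hconj : ∀ t r, (starRingEnd ℂ) (A t r) =
      ∑ c : ZMod p, (starRingEnd ℂ) (x t c) * ZMod.stdAddChar (r * c) := by
    intro t r
    rw [hA]
    simp only [map_sum, map_mul, conj_stdAddChar, neg_neg]
  -- each `(s,t)` block in Fourier form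
  have hst : ∀ s t : ZMod p, ∑ a : ZMod p, ∑ c : ZMod p,
      x s a * (starRingEnd ℂ) (x t c) * g s t (a - c) =
      (p : ℂ)⁻¹ * ∑ r : ZMod p, A s r * (starRingEnd ℂ) (A t r) *
        ∑ u : ZMod p, g s t u * ZMod.stdAddChar (r * u) := by
    intro s t
    rw [sum_sum_kernel_sub_eq (x s) (fun c => (starRingEnd ℂ) (x t c)) (g s t)]
    congr 1
    refine Finset.sum_congr rfl fun r _ => ?_
    rw [hconj]
  simp_rw [hst]
  -- pull out `p⁻¹ ∑_r`
  have hswap : ∑ s : ZMod p, ∑ t : ZMod p, (p : ℂ)⁻¹ * ∑ r : ZMod p,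
      A s r * (starRingEnd ℂ) (A t r) * ∑ u : ZMod p, g s t u * ZMod.stdAddChar (r * u) =
      (p : ℂ)⁻¹ * ∑ r : ZMod p, ∑ s : ZMod p, ∑ t : ZMod p,
        A s r * (starRingEnd ℂ) (A t r) * ∑ u : ZMod p, g s t u * ZMod.stdAddChar (r * u) := by
    simp_rw [← Finset.mul_sum]
    congr 1
    calc ∑ s : ZMod p, ∑ t : ZMod p, ∑ r : ZMod p,
          A s r * (starRingEnd ℂ) (A t r) * ∑ u : ZMod p, g s t u * ZMod.stdAddChar (r * u)
        = ∑ s : ZMod p, ∑ r : ZMod p, ∑ t : ZMod p,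
          A s r * (starRingEnd ℂ) (A t r) * ∑ u : ZMod p, g s t u * ZMod.stdAddChar (r * u) :=
          Finset.sum_congr rfl fun s _ => Finset.sum_comm
      _ = _ := Finset.sum_comm
  rw [hswap, norm_mul, norm_inv, Complex.norm_natCast]
  -- bound each frequency
  have hr : ∀ r : ZMod p, ‖∑ s : ZMod p, ∑ t : ZMod p,
      A s r * (starRingEnd ℂ) (A t r) * ∑ u : ZMod p, g s t u * ZMod.stdAddChar (r * u)‖ ≤
      B * ∑ s : ZMod p, ‖A s r‖ ^ 2 := by
    intro r
    refine hB r (fun s => A s r) ?_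
    rw [hA]
    simp only [hx, zero_mul, Finset.sum_const_zero]
  have hsum : ‖∑ r : ZMod p, ∑ s : ZMod p, ∑ t : ZMod p,
      A s r * (starRingEnd ℂ) (A t r) * ∑ u : ZMod p, g s t u * ZMod.stdAddChar (r * u)‖ ≤
      ∑ r : ZMod p, B * ∑ s : ZMod p, ‖A s r‖ ^ 2 :=
    (norm_sum_le _ _).trans (Finset.sum_le_sum fun r _ => hr r)
  -- Parseval in each `s`
  have hpars : ∑ r : ZMod p, B * ∑ s : ZMod p, ‖A s r‖ ^ 2 =
      B * ((p : ℝ) * ∑ s : ZMod p, ∑ a : ZMod p, ‖x s a‖ ^ 2) := by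
    rw [← Finset.mul_sum]
    congr 1
    rw [Finset.sum_comm, Finset.mul_sum]
    refine Finset.sum_congr rfl fun s _ => ?_
    rw [hA]
    exact sum_norm_sq_fourier_eq (x s)
  rw [hpars] at hsum
  calc (p : ℝ)⁻¹ * ‖∑ r : ZMod p, ∑ s : ZMod p, ∑ t : ZMod p,
        A s r * (starRingEnd ℂ) (A t r) * ∑ u : ZMod p, g s t u * ZMod.stdAddChar (r * u)‖
      ≤ (p : ℝ)⁻¹ * (B * ((p : ℝ) * ∑ s : ZMod p, ∑ a : ZMod p, ‖x s a‖ ^ 2)) :=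
        mul_le_mul_of_nonneg_left hsum (by positivity)
    _ = B * ∑ s : ZMod p, ∑ a : ZMod p, ‖x s a‖ ^ 2 := by
        field_simp

/-- **Dilation equivalence of the non-zero frequencies** (Kunisky–Yu, Proposition 4.19(2): the
twisted blocks `S(ψ)`, `ψ ≠ ψ₀`, share their spectrum): for a dilation-invariant kernel,
`g_{rs,rt}(ru) = g_{s,t}(u)` (`r ≠ 0`), the frequency-`r` form is a re-indexing of the
frequency-`1` form, so a bound at `r = 1` holds at every `r ≠ 0`.
[cite: KuniskyYu2022, Proposition 4.19] -/
theorem translationKernel_bound_of_one (g : ZMod p → ZMod p → ZMod p → ℂ)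
    (hg : ∀ r : ZMod p, r ≠ 0 → ∀ s t u : ZMod p, g (r * s) (r * t) (r * u) = g s t u) (B : ℝ)
    (h1 : ∀ y : ZMod p → ℂ, y 0 = 0 →
      ‖∑ s : ZMod p, ∑ t : ZMod p, y s * (starRingEnd ℂ) (y t) *
          ∑ u : ZMod p, g s t u * ZMod.stdAddChar u‖ ≤ B * ∑ s : ZMod p, ‖y s‖ ^ 2)
    {r : ZMod p} (hr : r ≠ 0) (y : ZMod p → ℂ) (hy : y 0 = 0) :
    ‖∑ s : ZMod p, ∑ t : ZMod p, y s * (starRingEnd ℂ) (y t) *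
        ∑ u : ZMod p, g s t u * ZMod.stdAddChar (r * u)‖ ≤ B * ∑ s : ZMod p, ‖y s‖ ^ 2 := by
  -- `∑_u g_{s,t}(u) e(ru) = ∑_u g_{rs,rt}(u) e(u)`
  have hG : ∀ s t : ZMod p, ∑ u : ZMod p, g s t u * (ZMod.stdAddChar (r * u) : ℂ) =
      ∑ u : ZMod p, g (r * s) (r * t) u * ZMod.stdAddChar u := by
    intro s t
    refine Fintype.sum_bijective (r * ·) (mulLeft_bijective₀ r hr) _ _ fun u => ?_
    show g s t u * _ = g (r * s) (r * t) (r * u) * _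
    rw [hg r hr s t u]
  simp_rw [hG]
  -- re-index `(s, t) ↦ (r s, r t)` and apply the frequency-`1` bound to `y' = y ∘ (r⁻¹ ·)`
  set y' : ZMod p → ℂ := fun s => y (r⁻¹ * s) with hy'
  have hy'r : ∀ s : ZMod p, y' (r * s) = y s := by
    intro s
    rw [hy']
    simp only
    rw [← mul_assoc, inv_mul_cancel₀ hr, one_mul]
  have hform : ∑ s : ZMod p, ∑ t : ZMod p, y s * (starRingEnd ℂ) (y t) *
      ∑ u : ZMod p, g (r * s) (r * t) u * (ZMod.stdAddChar u : ℂ) =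
      ∑ s : ZMod p, ∑ t : ZMod p, y' s * (starRingEnd ℂ) (y' t) *
        ∑ u : ZMod p, g s t u * (ZMod.stdAddChar u : ℂ) := by
    refine Fintype.sum_bijective (r * ·) (mulLeft_bijective₀ r hr) _ _ fun s => ?_
    refine Fintype.sum_bijective (r * ·) (mulLeft_bijective₀ r hr) _ _ fun t => ?_
    simp only [hy'r]
  have hnorm : ∑ s : ZMod p, ‖y s‖ ^ 2 = ∑ s : ZMod p, ‖y' s‖ ^ 2 := by
    refine Fintype.sum_bijective (r * ·) (mulLeft_bijective₀ r hr) _ _ fun s => ?_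
    simp only [hy'r]
  rw [hform, hnorm]
  refine h1 y' ?_
  rw [hy']
  simp only [mul_zero, hy]

/-- **Both frequency classes suffice**: for a dilation-invariant kernel, bounds `B` for the
frequency-`0` form and for the frequency-`1` form give `|pair-kernel form| ≤ B ∑ |x_s(a)|²`.
[cite: KuniskyYu2022, Proposition 4.19] -/
theorem norm_translationKernel_form_le_of_zero_one (g : ZMod p → ZMod p → ZMod p → ℂ)
    (hg : ∀ r : ZMod p, r ≠ 0 → ∀ s t u : ZMod p, g (r * s) (r * t) (r * u) = g s t u) (B : ℝ)
    (h0 : ∀ y : ZMod p → ℂ, y 0 = 0 →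
      ‖∑ s : ZMod p, ∑ t : ZMod p, y s * (starRingEnd ℂ) (y t) *
          ∑ u : ZMod p, g s t u‖ ≤ B * ∑ s : ZMod p, ‖y s‖ ^ 2)
    (h1 : ∀ y : ZMod p → ℂ, y 0 = 0 →
      ‖∑ s : ZMod p, ∑ t : ZMod p, y s * (starRingEnd ℂ) (y t) *
          ∑ u : ZMod p, g s t u * ZMod.stdAddChar u‖ ≤ B * ∑ s : ZMod p, ‖y s‖ ^ 2)
    (x : ZMod p → ZMod p → ℂ) (hx : ∀ a, x 0 a = 0) :
    ‖∑ s : ZMod p, ∑ t : ZMod p, ∑ a : ZMod p, ∑ c : ZMod p,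
        x s a * (starRingEnd ℂ) (x t c) * g s t (a - c)‖ ≤
      B * ∑ s : ZMod p, ∑ a : ZMod p, ‖x s a‖ ^ 2 := by
  refine norm_translationKernel_form_le g B (fun r y hy => ?_) x hx
  by_cases hr : r = 0
  · subst hr
    have h := h0 y hy
    simp only [zero_mul, AddChar.map_zero_eq_one, mul_one]
    exact h
  · exact translationKernel_bound_of_one g hg B h1 hr y hy

end Fourier

end Literature.Combinatorics.SimpleGraph

end
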